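import Literature.NumberTheory.GaloisRepresentations.GL2ModEightSignData
import HarnessLib

/-!
# `GL₂(ℤ/4ℤ)`: parities, the character `χ₋₁ ∘ det`, the kernel `1 + 2M₂(𝔽₂)`, the normaliser `ℍ`
# of the non-split Cartan (bookkeeping, proofs only)

`Proofs`-style helper layer (concrete bookkeeping definitions and kernel-decided tables only: no
named fact, no instance; D-0014/D-0026) for `GL2ModFourFullOrNormaliserProofs` — the group-theoretic input
to T. Dokchitser, V. Dokchitser, *Surjectivity of mod `2ⁿ` representations of elliptic curves*,
Math. Z. 272 (2012) 961–964, Theorem, clause (2).  Its proof (loc. cit., after the proof of (3)):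
"`GL₂(ℤ/4ℤ)` does have a (unique up to conjugacy) proper subgroup which surjects onto `GL₂(ℤ/2ℤ)`
and onto `(ℤ/4ℤ)^×`, and has a `C₂ × C₂`-quotient.  This group has index `4`, and is conjugate to
`ℍ = ⟨(0 1; 3 0), (0 1; 1 1)⟩ ≅ C₃ ⋊ D₈`."  Matrices are `Matrix (Fin 2) (Fin 2) (ZMod 4)`; every
finite statement is moved to the `4`-tuple of entries in `Q4 = (ℤ/4)⁴` (a product type, cheap for
kernel `decide`) by `tup`, and reductions modulo `2` live in `P4 = (ℤ/2)⁴` of `GL2ModEightSignData`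
(whose `P4.mul`, `P4.det`, `eps` are reused).

* §1 `tup`/`ofTup`, `Q4.mul/det/inv/par`, `par`, `cm1` (`χ₋₁`: `d = 3 ↦ 1`), `sg`, `inv'`;
* §2 the kernel `K = 1 + 2M₂(𝔽₂)`: `klift a` (`a ∈ P4`), `Q4.half`, products, conjugates and
  determinants of kernel elements (`klift_mul`, `conj_klift`, `cm1_det_klift`);
* §3 tables in `M₂(𝔽₂)` under `GL₂(𝔽₂)`-conjugation (the six rank-one idempotents, `{ω̄, ω̄²}`,
  `𝔽₄ = {0, 1, ω̄, ω̄²}`, the six nonzero non-identity trace-zero elements) and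
  `Hom(GL₂(𝔽₂), C₂) = {1, sgn}` (`hom_S3_cases`);
* §4 the non-split Cartan `ℤ/4·1 + ℤ/4·m` (`Q4.lin`), its stability under multiplication by `m` and
  transport under conjugation, `ℍ :=` the normaliser of `ℤ/4[w₀]`, `w₀ = (0 1; 1 1)` (`HH`: `24` of the `96`
  invertible tuples, contains both of DD's generators), the conjugacy of every lift of `ω̄` into `ℤ/4[w₀]` by an
  explicit kernel element (`kc`, `exists_kconj_lin_w0`), and: whatever normalises such a Cartan inside `ℤ/4[w₀]`
  normalises `ℤ/4[w₀]` (`normalises_w0_of_normalises`).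

## References

* [DokchitserDokchitserMathZ2012] T. Dokchitser, V. Dokchitser, Math. Z. 272 (2012) 961–964,
  proof of the Theorem, clause (2). [corpus:paper:arxiv-1104.5031 p0001 L99–L104]
* [SerreAbelianLAdic1968] J.-P. Serre, *Abelian `ℓ`-adic representations and elliptic curves*,
  Benjamin (1968), IV.3.4, Lemma 3 (subgroups of `GL₂(ℤ/ℓⁿℤ)` and `SL₂`).
-/

set_option autoImplicit false

namespace Literature.NumberTheory.GaloisRepresentations.GL2Mod4

open Matrix
open Literature.NumberTheory.GaloisRepresentations.GL2Mod8 (P4 P4.mul P4.det eps eps_mul)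

/-- `2 × 2` matrices over `ℤ/4ℤ` (bookkeeping abbreviation). [folklore] -/
abbrev M4 := Matrix (Fin 2) (Fin 2) (ZMod 4)

/-- `(ℤ/4)⁴`, the entries `(a, b, c, d)` of a matrix `(a b; c d)` (bookkeeping abbreviation). [folklore] -/
abbrev Q4 := ZMod 4 × ZMod 4 × ZMod 4 × ZMod 4

/-! ### §1. Tuples, reduction modulo `2`, `χ₋₁`, inverses -/

/-- Reduction modulo `2`, `ℤ/4ℤ → ℤ/2ℤ`. [folklore] -/
def red : ZMod 4 →+* ZMod 2 := ZMod.castHom (by norm_num : 2 ∣ 4) (ZMod 2)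

/-- The tuple of entries of a matrix. [folklore] -/
def tup (g : M4) : Q4 := (g 0 0, g 0 1, g 1 0, g 1 1)

/-- The matrix with given entries. [folklore] -/
def ofTup (q : Q4) : M4 := !![q.1, q.2.1; q.2.2.1, q.2.2.2]

/-- `tup (ofTup q) = q`. [cite: DokchitserDokchitserMathZ2012, proof of Theorem (2) (computation in GL₂(ℤ/4ℤ))] -/
theorem tup_ofTup (q : Q4) : tup (ofTup q) = q := by
  obtain ⟨a, b, c, d⟩ := q
  simp [tup, ofTup]

/-- `ofTup (tup g) = g`. [cite: DokchitserDokchitserMathZ2012, proof of Theorem (2) (computation in GL₂(ℤ/4ℤ))] -/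
theorem ofTup_tup (g : M4) : ofTup (tup g) = g := (Matrix.eta_fin_two g).symm

/-- `tup` is injective. [cite: DokchitserDokchitserMathZ2012, proof of Theorem (2) (computation in GL₂(ℤ/4ℤ))] -/
theorem tup_injective {g h : M4} (e : tup g = tup h) : g = h := by
  rw [← ofTup_tup g, ← ofTup_tup h, e]

/-- Product of tuples (matrix multiplication). [folklore] -/
def Q4.mul (p q : Q4) : Q4 :=
  (p.1 * q.1 + p.2.1 * q.2.2.1, p.1 * q.2.1 + p.2.1 * q.2.2.2,
    p.2.2.1 * q.1 + p.2.2.2 * q.2.2.1, p.2.2.1 * q.2.1 + p.2.2.2 * q.2.2.2)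

/-- Determinant of a tuple. [folklore] -/
def Q4.det (p : Q4) : ZMod 4 := p.1 * p.2.2.2 - p.2.1 * p.2.2.1

/-- `det • adj`, the inverse of a tuple of unit determinant (units of `ℤ/4` square to `1`). [folklore] -/
def Q4.inv (p : Q4) : Q4 :=
  (Q4.det p * p.2.2.2, -(Q4.det p * p.2.1), -(Q4.det p * p.2.2.1), Q4.det p * p.1)

/-- Reduction modulo `2` of a tuple. [folklore] -/
def Q4.par (p : Q4) : P4 := (red p.1, red p.2.1, red p.2.2.1, red p.2.2.2)

/-- `tup` is multiplicative. [cite: DokchitserDokchitserMathZ2012, proof of Theorem (2) (computation in GL₂(ℤ/4ℤ))] -/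
theorem tup_mul (g h : M4) : tup (g * h) = Q4.mul (tup g) (tup h) := by
  simp [tup, Q4.mul, Matrix.mul_apply, Fin.sum_univ_two]

/-- `tup 1 = (1, 0, 0, 1)`. [cite: DokchitserDokchitserMathZ2012, proof of Theorem (2) (computation in GL₂(ℤ/4ℤ))] -/
theorem tup_one : tup (1 : M4) = (1, 0, 0, 1) := by decide

/-- `det` through `tup`. [cite: DokchitserDokchitserMathZ2012, proof of Theorem (2) (computation in GL₂(ℤ/4ℤ))] -/
theorem det_eq (g : M4) : g.det = Q4.det (tup g) := by
  rw [Matrix.det_fin_two]; rfl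

/-- The parity vector (reduction modulo `2`) of a matrix over `ℤ/4`. [folklore] -/
def par (g : M4) : P4 := Q4.par (tup g)

/-- `Q4.par` is multiplicative. [cite: DokchitserDokchitserMathZ2012, proof of Theorem (2) (computation in GL₂(ℤ/4ℤ))] -/
theorem Q4.par_mul (p q : Q4) : Q4.par (Q4.mul p q) = P4.mul (Q4.par p) (Q4.par q) := by
  simp [Q4.par, Q4.mul, P4.mul, map_add, map_mul]

/-- `par` is multiplicative. [cite: DokchitserDokchitserMathZ2012, proof of Theorem (2) (computation in GL₂(ℤ/4ℤ))] -/
theorem par_mul (g h : M4) : par (g * h) = P4.mul (par g) (par h) := by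
  simp only [par, tup_mul, Q4.par_mul]

/-- `par 1 = 1̄`. [cite: DokchitserDokchitserMathZ2012, proof of Theorem (2) (computation in GL₂(ℤ/4ℤ))] -/
theorem par_one : par (1 : M4) = (1, 0, 0, 1) := by decide

/-- `red (det) = det (par)`. [cite: DokchitserDokchitserMathZ2012, proof of Theorem (2) (computation in GL₂(ℤ/4ℤ))] -/
theorem Q4.red_det (p : Q4) : red (Q4.det p) = P4.det (Q4.par p) := by
  simp [Q4.det, Q4.par, P4.det, map_sub, map_mul]

/-- The units of `ℤ/4` are `1, 3`, of square `1`, detected by `red`. [cite: DokchitserDokchitserMathZ2012, proof of Theorem (2) (computation in GL₂(ℤ/4ℤ))] -/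
theorem mul_self_eq_one_iff (d : ZMod 4) : d * d = 1 ↔ red d = 1 := by revert d; decide

/-- `d d' = 1 ⟹ d² = 1`. [cite: DokchitserDokchitserMathZ2012, proof of Theorem (2) (computation in GL₂(ℤ/4ℤ))] -/
theorem mul_self_of_mul_eq_one {d d' : ZMod 4} (h : d * d' = 1) : d * d = 1 := by
  revert d d'; decide

/-- A tuple has unit determinant iff its reduction has determinant `1`. [cite: DokchitserDokchitserMathZ2012, proof of Theorem (2) (computation in GL₂(ℤ/4ℤ))] -/
theorem Q4.det_mul_self_iff (p : Q4) : Q4.det p * Q4.det p = 1 ↔ P4.det (Q4.par p) = 1 := by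
  rw [mul_self_eq_one_iff, Q4.red_det]

/-- The additive character `χ₋₁` of `(ℤ/4)^×`: `cm1 d = 1` iff `d = 3` (`σ(i) = i^{det} = -i` iff
`det ≡ 3 (mod 4)`). [folklore] -/
def cm1 (d : ZMod 4) : ZMod 2 := if d = 3 then 1 else 0

/-- `cm1` is additive on units. [cite: DokchitserDokchitserMathZ2012, proof of Theorem (2) (computation in GL₂(ℤ/4ℤ))] -/
theorem cm1_mul {d d' : ZMod 4} (hd : d * d = 1) (hd' : d' * d' = 1) :
    cm1 (d * d') = cm1 d + cm1 d' := by
  revert d d'; decide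

/-- A unit with `cm1 = 0` is `1`. [cite: DokchitserDokchitserMathZ2012, proof of Theorem (2) (computation in GL₂(ℤ/4ℤ))] -/
theorem eq_one_of_cm1 {d : ZMod 4} (hd : d * d = 1) (h : cm1 d = 0) : d = 1 := by
  revert d; decide

/-- The sign of (the reduction of) a matrix over `ℤ/4` in `GL₂(𝔽₂) ≅ S₃`. [folklore] -/
def sg (g : M4) : ZMod 2 := eps (par g)

/-- `sg` is additive on invertible matrices. [cite: DokchitserDokchitserMathZ2012, proof of Theorem (2) (computation in GL₂(ℤ/4ℤ))] -/
theorem sg_mul {g h : M4} (hg : g.det * g.det = 1) (hh : h.det * h.det = 1) :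
    sg (g * h) = sg g + sg h := by
  unfold sg
  rw [par_mul]
  refine eps_mul _ _ ?_ ?_
  · exact (Q4.det_mul_self_iff _).mp (by rw [← det_eq]; exact hg)
  · exact (Q4.det_mul_self_iff _).mp (by rw [← det_eq]; exact hh)

/-- The inverse of a matrix with `det² = 1`: `det • adj`. [folklore] -/
def inv' (s : M4) : M4 := s.det • s.adjugate

/-- `s · inv' s = 1`. [cite: DokchitserDokchitserMathZ2012, proof of Theorem (2) (computation in GL₂(ℤ/4ℤ))] -/
theorem mul_inv' {s : M4} (hs : s.det * s.det = 1) : s * inv' s = 1 := by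
  rw [inv', Matrix.mul_smul, Matrix.mul_adjugate, smul_smul, hs, one_smul]

/-- `inv' s · s = 1`. [cite: DokchitserDokchitserMathZ2012, proof of Theorem (2) (computation in GL₂(ℤ/4ℤ))] -/
theorem inv'_mul {s : M4} (hs : s.det * s.det = 1) : inv' s * s = 1 := by
  rw [inv', Matrix.smul_mul, Matrix.adjugate_mul, smul_smul, hs, one_smul]

/-- Uniqueness of inverses: `s t = 1 ⟹ inv' s = t`. [cite: DokchitserDokchitserMathZ2012, proof of Theorem (2) (computation in GL₂(ℤ/4ℤ))] -/
theorem inv'_eq_of_mul_eq_one {s t : M4} (hs : s.det * s.det = 1) (h : s * t = 1) : inv' s = t := by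
  calc inv' s = inv' s * (s * t) := by rw [h, mul_one]
    _ = t := by rw [← mul_assoc, inv'_mul hs, one_mul]

/-- `tup (inv' s) = Q4.inv (tup s)`. [cite: DokchitserDokchitserMathZ2012, proof of Theorem (2) (computation in GL₂(ℤ/4ℤ))] -/
theorem tup_inv' (s : M4) : tup (inv' s) = Q4.inv (tup s) := by
  simp [tup, inv', Q4.inv, Q4.det, Matrix.adjugate_fin_two, Matrix.det_fin_two, Matrix.smul_apply]

/-- `det (inv' s)` is a unit. [cite: DokchitserDokchitserMathZ2012, proof of Theorem (2) (computation in GL₂(ℤ/4ℤ))] -/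
theorem det_inv'_mul_self {s : M4} (hs : s.det * s.det = 1) : (inv' s).det * (inv' s).det = 1 := by
  have h : (inv' s).det * s.det = 1 := by rw [← Matrix.det_mul, inv'_mul hs, Matrix.det_one]
  exact mul_self_of_mul_eq_one h

set_option maxRecDepth 100000 in
set_option maxHeartbeats 0 in
/-- `det² = 1 ⟹ det (par) = 1` and the reduction of the inverse is the adjugate of the reduction. [cite: DokchitserDokchitserMathZ2012, proof of Theorem (2) (computation in GL₂(ℤ/4ℤ))] -/
theorem Q4.par_inv : ∀ g : Q4, Q4.det g * Q4.det g = 1 →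
    Q4.par (Q4.inv g) = ((Q4.par g).2.2.2, (Q4.par g).2.1, (Q4.par g).2.2.1, (Q4.par g).1) := by
  decide +kernel

/-- The reduction of `inv' t` is the adjugate of the reduction of `t`. [cite: DokchitserDokchitserMathZ2012, proof of Theorem (2) (computation in GL₂(ℤ/4ℤ))] -/
theorem par_inv' (t : M4) (ht : t.det * t.det = 1) :
    par (inv' t) = ((par t).2.2.2, (par t).2.1, (par t).2.2.1, (par t).1) := by
  unfold par
  rw [tup_inv']
  exact Q4.par_inv _ (by rw [← det_eq]; exact ht)

/-- `det` is multiplicative on parity matrices; `p · adj p = 1 = adj p · p` when `det p = 1`. [cite: DokchitserDokchitserMathZ2012, proof of Theorem (2) (computation in GL₂(ℤ/4ℤ))] -/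
theorem P4.det_mul_and_adj : (∀ p q : P4, P4.det (P4.mul p q) = P4.det p * P4.det q) ∧
    ∀ p : P4, P4.det p = 1 → P4.mul p (p.2.2.2, p.2.1, p.2.2.1, p.1) = (1, 0, 0, 1) ∧
      P4.mul (p.2.2.2, p.2.1, p.2.2.1, p.1) p = (1, 0, 0, 1) := by
  refine ⟨by decide, by decide⟩

/-! ### §2. The kernel `K = 1 + 2M₂(𝔽₂)` of reduction -/

/-- The second binary digit of a residue modulo `4` (`0, 1 ↦ 0`, `2, 3 ↦ 1`). [folklore] -/
def bit1 (x : ZMod 4) : ZMod 2 := if x = 2 ∨ x = 3 then 1 else 0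

/-- `0 ↦ 0`, `1 ↦ 2`: twice a lift. [folklore] -/
def twice (x : ZMod 2) : ZMod 4 := if x = 0 then 0 else 2

/-- `A ↦ 1 + 2A`, from `M₂(𝔽₂)` (as `P4`) onto the kernel of reduction, in `(ℤ/4)⁴`. [folklore] -/
def klift (a : P4) : Q4 := (1 + twice a.1, twice a.2.1, twice a.2.2.1, 1 + twice a.2.2.2)

/-- `1 + 2A ↦ A`: the half of a kernel tuple. [folklore] -/
def Q4.half (q : Q4) : P4 := (bit1 q.1, bit1 q.2.1, bit1 q.2.2.1, bit1 q.2.2.2)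

set_option maxRecDepth 100000 in
set_option maxHeartbeats 0 in
/-- A tuple `≡ 1 (mod 2)` is `klift` of its half. [cite: DokchitserDokchitserMathZ2012, proof of Theorem (2) (computation in GL₂(ℤ/4ℤ))] -/
theorem eq_klift_half : ∀ q : Q4, Q4.par q = (1, 0, 0, 1) → q = klift (Q4.half q) := by
  decide +kernel

/-- `half (klift a) = a`, `par (klift a) = 1̄`, `det (klift a)² = 1`, `χ₋₁ (det (1 + 2A)) = tr A`,
and `klift 0 = 1`. [cite: DokchitserDokchitserMathZ2012, proof of Theorem (2) (computation in GL₂(ℤ/4ℤ))] -/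
theorem klift_facts : (∀ a : P4, Q4.half (klift a) = a ∧ Q4.par (klift a) = (1, 0, 0, 1) ∧
    Q4.det (klift a) * Q4.det (klift a) = 1 ∧ cm1 (Q4.det (klift a)) = a.1 + a.2.2.2) ∧
    klift 0 = (1, 0, 0, 1) := by
  refine ⟨by decide, by decide⟩

/-- `(1 + 2A)(1 + 2B) = 1 + 2(A + B)`. [cite: DokchitserDokchitserMathZ2012, proof of Theorem (2) (computation in GL₂(ℤ/4ℤ))] -/
theorem klift_mul : ∀ a b : P4, Q4.mul (klift a) (klift b) = klift (a + b) := by decide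

/-- Conjugation in `M₂(𝔽₂)` by `p` of determinant `1`: `A ↦ p A p⁻¹ = p A adj(p)`. [folklore] -/
def P4.conj (p a : P4) : P4 := P4.mul (P4.mul p a) (p.2.2.2, p.2.1, p.2.2.1, p.1)

set_option maxRecDepth 100000 in
set_option maxHeartbeats 0 in
/-- `g (1 + 2A) g⁻¹ = 1 + 2 (ḡ A ḡ⁻¹)` for invertible `g`. [cite: DokchitserDokchitserMathZ2012, proof of Theorem (2) (computation in GL₂(ℤ/4ℤ))] -/
theorem conj_klift : ∀ g : Q4, Q4.det g * Q4.det g = 1 → ∀ a : P4,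
    Q4.mul (Q4.mul g (klift a)) (Q4.inv g) = klift (P4.conj (Q4.par g) a) := by
  decide +kernel

/-! ### §3. Tables in `M₂(𝔽₂)` under conjugation by `GL₂(𝔽₂) ≅ S₃` -/

/-- The six rank-one idempotents of `M₂(𝔽₂)` (the conjugacy class of `E₁₁`). [folklore] -/
def idem6 : Finset P4 :=
  {(1, 0, 0, 0), (0, 0, 0, 1), (1, 1, 0, 0), (0, 0, 1, 1), (1, 0, 1, 0), (0, 1, 0, 1)}

/-- `{ω̄, ω̄²}`, the two elements of order `3` (`ω̄ = (0 1; 1 1)`). [folklore] -/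
def omega2 : Finset P4 := {(0, 1, 1, 1), (1, 1, 1, 0)}

/-- `𝔽₄ = {0, 1, ω̄, ω̄²} ⊂ M₂(𝔽₂)`. [folklore] -/
def F4set : Finset P4 := {(0, 0, 0, 0), (1, 0, 0, 1), (0, 1, 1, 1), (1, 1, 1, 0)}

/-- The six nonzero, non-identity trace-zero elements (three nilpotents, three involutions). [folklore] -/
def sl2six : Finset P4 :=
  {(0, 1, 0, 0), (0, 0, 1, 0), (1, 1, 1, 1), (0, 1, 1, 0), (1, 1, 0, 1), (1, 0, 1, 1)}

/-- `M₂(𝔽₂) = 𝔽₂[ω̄] ∪ idem6 ∪ sl2six`. [cite: DokchitserDokchitserMathZ2012, proof of Theorem (2) (computation in GL₂(ℤ/4ℤ))] -/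
theorem P4_cover : ∀ a : P4, a ∈ F4set ∨ a ∈ idem6 ∨ a ∈ sl2six := by decide

/-- Members of `𝔽₂[ω̄]` other than `ω̄, ω̄²`, and members of `sl2six`, have trace `0`. [cite: DokchitserDokchitserMathZ2012, proof of Theorem (2) (computation in GL₂(ℤ/4ℤ))] -/
theorem P4_trace_zero : (∀ a : P4, a ∈ F4set → a ∈ omega2 ∨ a.1 + a.2.2.2 = 0) ∧
    ∀ a : P4, a ∈ sl2six → a.1 + a.2.2.2 = 0 := by
  refine ⟨by decide, by decide⟩

/-- The rank-one idempotents form one conjugacy class under `GL₂(𝔽₂)`. [cite: DokchitserDokchitserMathZ2012, proof of Theorem (2) (computation in GL₂(ℤ/4ℤ))] -/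
theorem idem6_conj : ∀ a ∈ idem6, ∀ b ∈ idem6, ∃ p : P4, P4.det p = 1 ∧ P4.conj p a = b := by
  decide

/-- `ω̄ + (trace-zero, nonzero, non-identity)` is a rank-one idempotent, and conjugation preserves
`{ω̄, ω̄²}`. [cite: DokchitserDokchitserMathZ2012, proof of Theorem (2) (computation in GL₂(ℤ/4ℤ))] -/
theorem omega2_facts : (∀ a ∈ omega2, ∀ b ∈ sl2six, a + b ∈ idem6) ∧
    (∀ p : P4, P4.det p = 1 → P4.conj p (0, 1, 1, 1) = (0, 1, 1, 1) ∨
      P4.conj p (0, 1, 1, 1) = (1, 1, 1, 0)) := by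
  refine ⟨by decide, by decide⟩

/-- The matrix units: `E₁₂ = (1 1; 0 0) + E₁₁`, `E₂₁ = (1 0; 1 0) + E₁₁`, and every element is the
sum of its nonzero entries' matrix units. [cite: DokchitserDokchitserMathZ2012, proof of Theorem (2) (computation in GL₂(ℤ/4ℤ))] -/
theorem P4_units : ((1, 1, 0, 0) : P4) + (1, 0, 0, 0) = (0, 1, 0, 0) ∧
    ((1, 0, 1, 0) : P4) + (1, 0, 0, 0) = (0, 0, 1, 0) ∧
    ∀ a : P4, a = (if a.1 = 1 then (1, 0, 0, 0) else 0) + (if a.2.1 = 1 then (0, 1, 0, 0) else 0) +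
      (if a.2.2.1 = 1 then (0, 0, 1, 0) else 0) + (if a.2.2.2 = 1 then (0, 0, 0, 1) else 0) := by
  refine ⟨by decide, by decide, by decide⟩

/-- The six elements of `GL₂(𝔽₂)`, indexed: `1, ω̄, ω̄², u₁, u₂, u₃`. [folklore] -/
def gl2 : Fin 6 → P4 :=
  ![(1, 0, 0, 1), (0, 1, 1, 1), (1, 1, 1, 0), (0, 1, 1, 0), (1, 1, 0, 1), (1, 0, 1, 1)]

/-- Index in `gl2` of an element of `GL₂(𝔽₂)` (junk `0` elsewhere). [folklore] -/
def gl2idx (p : P4) : Fin 6 :=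
  if p = (0, 1, 1, 1) then 1 else if p = (1, 1, 1, 0) then 2 else if p = (0, 1, 1, 0) then 3 else
  if p = (1, 1, 0, 1) then 4 else if p = (1, 0, 1, 1) then 5 else 0

/-- `gl2 (gl2idx p) = p` on `GL₂(𝔽₂)`, and `det (gl2 i) = 1`. [cite: DokchitserDokchitserMathZ2012, proof of Theorem (2) (computation in GL₂(ℤ/4ℤ))] -/
theorem gl2_gl2idx : (∀ p : P4, P4.det p = 1 → gl2 (gl2idx p) = p) ∧ ∀ i, P4.det (gl2 i) = 1 := by
  refine ⟨by decide, by decide⟩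

/-- Six bits, read as a function on `GL₂(𝔽₂)` through `gl2`. [folklore] -/
def F6 (f : ZMod 2 × ZMod 2 × ZMod 2 × ZMod 2 × ZMod 2 × ZMod 2) (i : Fin 6) : ZMod 2 :=
  ![f.1, f.2.1, f.2.2.1, f.2.2.2.1, f.2.2.2.2.1, f.2.2.2.2.2] i

/-- **`Hom(GL₂(𝔽₂), C₂) = {1, sgn}`** (`S₃^{ab} ≅ C₂`): a `ℤ/2`-valued homomorphism on
`GL₂(𝔽₂) ≅ S₃` is trivial or the sign `eps` (kernel check of the `64 × 36` cases). [cite: DokchitserDokchitserMathZ2012, proof of Theorem (2) ("has a C₂ × C₂-quotient")] -/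
theorem hom_S3_cases : ∀ f : ZMod 2 × ZMod 2 × ZMod 2 × ZMod 2 × ZMod 2 × ZMod 2,
    (∀ i j : Fin 6, F6 f (gl2idx (P4.mul (gl2 i) (gl2 j))) = F6 f i + F6 f j) →
      (∀ i, F6 f i = 0) ∨ ∀ i, F6 f i = eps (gl2 i) := by
  decide

/-! ### §4. The non-split Cartan `ℤ/4[m]`, its normaliser, `ℍ` -/

/-- `a·1 + b·m` in `(ℤ/4)⁴`. [folklore] -/
def Q4.lin (a b : ZMod 4) (m : Q4) : Q4 := (a + b * m.1, b * m.2.1, b * m.2.2.1, a + b * m.2.2.2)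

/-- Cayley–Hamilton: `(a·1 + b·m)·m = -b·det(m)·1 + (a + b·tr(m))·m`, so `ℤ/4·1 + ℤ/4·m` is
closed under multiplication by `m`. [cite: DokchitserDokchitserMathZ2012, proof of Theorem (2) (computation in GL₂(ℤ/4ℤ))] -/
theorem Q4.lin_mul_gen (a b : ZMod 4) (m : Q4) : Q4.mul (Q4.lin a b m) m =
    Q4.lin (-(b * (m.1 * m.2.2.2 - m.2.1 * m.2.2.1))) (a + b * (m.1 + m.2.2.2)) m := by
  obtain ⟨m₁, m₂, m₃, m₄⟩ := m
  simp only [Q4.mul, Q4.lin, Prod.mk.injEq]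
  refine ⟨by ring, by ring, by ring, by ring⟩

/-- Conjugation is linear: `k (a·1 + b·m) k⁻¹ = a·1 + b·(k m k⁻¹)` for `det k` a unit. [cite: DokchitserDokchitserMathZ2012, proof of Theorem (2) (computation in GL₂(ℤ/4ℤ))] -/
theorem Q4.conj_lin (k m : Q4) (hk : Q4.det k * Q4.det k = 1) (a b : ZMod 4) :
    Q4.mul (Q4.mul k (Q4.lin a b m)) (Q4.inv k) = Q4.lin a b (Q4.mul (Q4.mul k m) (Q4.inv k)) := by
  obtain ⟨k₁, k₂, k₃, k₄⟩ := k
  obtain ⟨m₁, m₂, m₃, m₄⟩ := m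
  have hk' : (k₁ * k₄ - k₂ * k₃) * (k₁ * k₄ - k₂ * k₃) = 1 := hk
  simp only [Q4.mul, Q4.inv, Q4.det, Q4.lin, Prod.mk.injEq]
  refine ⟨?_, ?_, ?_, ?_⟩
  · linear_combination a * hk'
  · ring
  · ring
  · linear_combination a * hk'

/-- `w₀ = (0 1; 1 1)`, a lift of `ω̄`; `ℤ/4[w₀] ≅ ℤ/4[t]/(t² - t - 1)` is the non-split Cartan
subalgebra (unramified: `t² + t + 1 ≡ t² - t - 1 (mod 2)` is irreducible). [folklore] -/
def w0 : Q4 := (0, 1, 1, 1)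

/-- **`ℍ`** — the invertible tuples `h` with `h w₀ h⁻¹ ∈ ℤ/4·1 + ℤ/4·w₀`, i.e. the normaliser in
`GL₂(ℤ/4ℤ)` of the non-split Cartan `ℤ/4[w₀]^×`; by `HH_facts` it has `24` elements (index `4`) and
contains Dokchitser–Dokchitser's generators `(0 1; 3 0)`, `(0 1; 1 1)` of their
`ℍ ≅ C₃ ⋊ D₈` of index `4` — so, granted loc. cit. "this group has index 4", it IS their `ℍ` in
these coordinates. [cite: DokchitserDokchitserMathZ2012, proof of Theorem (2) (the subgroup ℍ)] -/
def HH : Finset Q4 :=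
  Finset.univ.filter fun h ↦ Q4.det h * Q4.det h = 1 ∧
    ∃ ab : ZMod 4 × ZMod 4, Q4.mul (Q4.mul h w0) (Q4.inv h) = Q4.lin ab.1 ab.2 w0

set_option maxRecDepth 100000 in
set_option maxHeartbeats 0 in
/-- `|GL₂(ℤ/4ℤ)| = 96`, `|ℍ| = 24`, and DD's generators `(0 1; 3 0)`, `(0 1; 1 1)` lie in `ℍ`. [cite: DokchitserDokchitserMathZ2012, proof of Theorem (2) ("this group has index 4, and is conjugate to ℍ")] -/
theorem HH_facts : (Finset.univ.filter fun g : Q4 ↦ Q4.det g * Q4.det g = 1).card = 96 ∧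
    HH.card = 24 ∧ ((0, 1, 3, 0) : Q4) ∈ HH ∧ ((0, 1, 1, 1) : Q4) ∈ HH := by
  refine ⟨by decide +kernel, by decide +kernel, by decide +kernel, by decide +kernel⟩

/-- Membership in `ℍ`, unfolded. [cite: DokchitserDokchitserMathZ2012, proof of Theorem (2) (the subgroup ℍ)] -/
theorem mem_HH_iff (h : Q4) : h ∈ HH ↔ Q4.det h * Q4.det h = 1 ∧
    ∃ ab : ZMod 4 × ZMod 4, Q4.mul (Q4.mul h w0) (Q4.inv h) = Q4.lin ab.1 ab.2 w0 := by
  simp [HH]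

/-- A kernel element `1 + 2·kc(N)` conjugating the lift `w₀ + 2N` of `ω̄` into `ℤ/4[w₀]`: `kc N = C`
with `[C, ω̄] ≡ N (mod 𝔽₂[ω̄])` (`ad ω̄` maps `E₁₁, E₁₂, E₂₁` onto the three involutions, a complement
of `𝔽₂[ω̄]`). [folklore] -/
def kc (n : P4) : P4 :=
  if n ∈ F4set then 0 else if n + (0, 1, 1, 0) ∈ F4set then (1, 0, 0, 0)
  else if n + (1, 1, 0, 1) ∈ F4set then (0, 1, 0, 0) else (0, 0, 1, 0)

set_option maxRecDepth 100000 in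
set_option maxHeartbeats 0 in
/-- Every lift `m` of `ω̄` is conjugate, by the kernel element `1 + 2·kc`, into `ℤ/4·1 + ℤ/4·w₀`
(all non-split Cartans of level `4` are conjugate). [cite: DokchitserDokchitserMathZ2012, proof of Theorem (2) ("unique up to conjugacy")] -/
theorem exists_kconj_lin_w0 : ∀ m : Q4, Q4.par m = (0, 1, 1, 1) → ∃ ab : ZMod 4 × ZMod 4,
    Q4.mul (Q4.mul (klift (kc (Q4.half m))) m) (Q4.inv (klift (kc (Q4.half m)))) =
      Q4.lin ab.1 ab.2 w0 := by
  decide +kernel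

set_option maxRecDepth 100000 in
set_option maxHeartbeats 0 in
/-- For a lift `m` of `ω̄`: the kernel elements over `𝔽₄ = {0, 1, ω̄, ω̄²}` lie in `ℤ/4·1 + ℤ/4·m`,
and so do `m` and `m²`' partners: `1 + 2c ∈ ℤ/4[m]` for `c ∈ 𝔽₂[ω̄]`.
[cite: DokchitserDokchitserMathZ2012, proof of Theorem (2) (computation in GL₂(ℤ/4ℤ))] -/
theorem klift_F4_mem_lin : ∀ c : P4, c ∈ F4set → ∀ m : Q4, Q4.par m = (0, 1, 1, 1) →
    ∃ ab : ZMod 4 × ZMod 4, klift c = Q4.lin ab.1 ab.2 m := by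
  decide +kernel

set_option maxRecDepth 100000 in
set_option maxHeartbeats 0 in
/-- **The normaliser of a non-split Cartan in `ℤ/4[w₀]`-position normalises `ℤ/4[w₀]`** (so lies in
`ℍ`, `mem_HH_iff`): if `m' ≡ ω̄ (mod 2)` lies in `ℤ/4·1 + ℤ/4·w₀` then `ℤ/4[m'] = ℤ/4[w₀]`, and every
invertible `h` with `h m' h⁻¹ ∈ ℤ/4[m']` has `h w₀ h⁻¹ ∈ ℤ/4[w₀]`.
[cite: DokchitserDokchitserMathZ2012, proof of Theorem (2) (the subgroup ℍ has index 4)] -/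
theorem normalises_w0_of_normalises : ∀ ab : ZMod 4 × ZMod 4,
    Q4.par (Q4.lin ab.1 ab.2 w0) = (0, 1, 1, 1) → ∀ h : Q4, Q4.det h * Q4.det h = 1 →
      (∃ cd : ZMod 4 × ZMod 4, Q4.mul (Q4.mul h (Q4.lin ab.1 ab.2 w0)) (Q4.inv h) =
        Q4.lin cd.1 cd.2 (Q4.lin ab.1 ab.2 w0)) →
      ∃ ef : ZMod 4 × ZMod 4, Q4.mul (Q4.mul h w0) (Q4.inv h) = Q4.lin ef.1 ef.2 w0 := by
  decide +kernel

end Literature.NumberTheory.GaloisRepresentations.GL2Mod4
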